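import Summits.ValiantsHypothesis.ValiantsHypothesis.Theorems.BarrierLeverPartitionMinorsHitByVPProductStateSums

/-!
# Route BarrierLever — item `PartitionMinorsHitByVP` (stmt-ValiantsHypothesis-19717):
# the POLYNOMIAL-SIZE RANGE — every injective layout with `r ≤ (2h)^c` rows is hit, `b = c + 2`

Helper file (`--supports stmt-ValiantsHypothesis-19717`; cell valiant-natproofs, rung V4, 𝒟-side, prover seat
val-np-p3). Closes NO item. An UNCONDITIONAL partial range of item 19717, stated honestly: the item quantifies
over all sizes `r ≤ 2^h`; here `r ≤ (h+h)^c` for a fixed exponent `c` (and `h ≥ 4`).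

**Theorem (`partitionMinor_hit_of_card_le`).** For `h ≥ 4`, `r ≤ (h+h)^c` and injective `u, w : Fin r → Finset (Fin h)`
there is `f ∈ SmallCircuits ℂ (h+h) (c+2)` with `det (coeff_{x^{u_i} y^{w_j}} f)_{i,j} ≠ 0` (the matrix of item
19717 verbatim). *Proof.* A max-plus certificate with `m = r` DEDICATED product states
(`…ProductStateSums.partitionMinor_hit_of_maxPlusCertificate`): expert `k` (identity pairing) scores a pair
`(U, W)` by `#{a : [a ∈ U] = [a ∈ u_k] ∧ [a ∈ W] = [a ∈ w_k]}`, which is `h` exactly on `(u_k, w_k)` and `≤ h − 1`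
on every other pair of the layout (injectivity), so the identity is the unique optimal assignment.
`partitionMinorsHitByVP_smallLayouts` packages the range in the shape of the item (`∀ c ∃ b h₀ …` with the extra
hypothesis `r ≤ (h+h)^c`).

WHAT THIS IS NOT: nothing for `r` super-polynomial in `h` (the content of item 19717); nothing on crux 14610.
-/

-- layout Summits/ValiantsHypothesis/ValiantsHypothesis forces the duplicated namespace component
set_option linter.dupNamespace false

namespace Summit.ValiantsHypothesis.ValiantsHypothesis.Theorems.BarrierLever.ProductStateSums

open Finset MvPolynomial Literature.Barriers.ValiantsHypothesis

/-- The dedicated score of expert `k` on the pair `(i, j)`: at most `h`. -/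
theorem dedicatedScore_le {h r : ℕ} (u w : Fin r → Finset (Fin h)) (k i j : Fin r) :
    (∑ a : Fin h, (if (decide (a ∈ u i) = decide (a ∈ u k) ∧ decide (a ∈ w j) = decide (a ∈ w k))
      then 1 else 0 : ℕ)) ≤ h := by
  calc (∑ a : Fin h, (if (decide (a ∈ u i) = decide (a ∈ u k) ∧ decide (a ∈ w j) = decide (a ∈ w k))
        then 1 else 0 : ℕ)) ≤ ∑ _a : Fin h, 1 := Finset.sum_le_sum fun a _ => by split_ifs <;> simp
    _ = h := by simp

/-- The dedicated score of expert `k` on `(i, j)` equals `h` only if `u i = u k` and `w j = w k`. -/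
theorem eq_of_dedicatedScore_eq {h r : ℕ} (u w : Fin r → Finset (Fin h)) (k i j : Fin r)
    (hk : (∑ a : Fin h, (if (decide (a ∈ u i) = decide (a ∈ u k) ∧ decide (a ∈ w j) = decide (a ∈ w k))
      then 1 else 0 : ℕ)) = h) : u i = u k ∧ w j = w k := by
  -- every summand must be `1`
  have hall : ∀ a : Fin h, decide (a ∈ u i) = decide (a ∈ u k) ∧ decide (a ∈ w j) = decide (a ∈ w k) := by
    by_contra hcon
    push Not at hcon
    obtain ⟨a₀, ha₀⟩ := hcon
    have hlt : (∑ a : Fin h, (if (decide (a ∈ u i) = decide (a ∈ u k) ∧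
        decide (a ∈ w j) = decide (a ∈ w k)) then 1 else 0 : ℕ)) < ∑ _a : Fin h, 1 := by
      refine Finset.sum_lt_sum (fun a _ => by split_ifs <;> simp) ⟨a₀, mem_univ _, ?_⟩
      rw [if_neg (fun h' => ha₀ h'.1 h'.2)]
      exact Nat.zero_lt_one
    rw [hk] at hlt
    simp at hlt
  constructor
  · ext a
    have := (hall a).1
    simpa using this
  · ext a
    have := (hall a).2
    simpa using this

/-- **The polynomial-size range of item 19717.** Every injective layout with `1 ≤ r ≤ (h+h)^c` rows
(`h ≥ 4`) is hit by `SmallCircuits ℂ (h+h) (c+2)`. -/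
theorem partitionMinor_hit_of_card_le (c h : ℕ) (hh : 4 ≤ h) (r : ℕ) (hr : r ≤ (h + h) ^ c)
    (u w : Fin r → Finset (Fin h)) (hu : Function.Injective u) (hw : Function.Injective w) :
    ∃ f ∈ SmallCircuits ℂ (h + h) (c + 2),
      (Matrix.of fun i j : Fin r => MvPolynomial.coeff
        (∑ a ∈ u i, Finsupp.single (Fin.castAdd h a) 1 +
          ∑ c ∈ w j, Finsupp.single (Fin.natAdd h c) 1) f).det ≠ 0 := by
  rcases Nat.eq_zero_or_pos r with hr0 | hr0
  · -- empty layout: the determinant of the empty matrix is `1`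
    subst hr0
    refine ⟨0, ⟨by simp, ?_⟩, ?_⟩
    · rw [← C_0, Literature.Computability.AlgebraicComplexity.complexity_C_holds]; exact Nat.zero_le _
    · simp [Matrix.det_isEmpty]
  -- dedicated experts: `m = r`, identity pairings, indicator tables
  have key := partitionMinor_hit_of_maxPlusCertificate c h hh r u w r hr0 hr (fun _ => 1)
    (fun k a e e' => if (e = decide (a ∈ u k) ∧ e' = decide (a ∈ w k)) then 1 else 0) 1
  apply key
  intro σ hσ
  simp only [Equiv.Perm.coe_one, id_eq]
  -- right-hand side: every diagonal pair scores `h`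
  have hdiag : ∀ j : Fin r, univ.sup (fun k => ∑ a : Fin h,
      (if (decide (a ∈ u j) = decide (a ∈ u k) ∧ decide (a ∈ w j) = decide (a ∈ w k)) then 1 else 0 : ℕ)) = h := by
    intro j
    refine le_antisymm (Finset.sup_le fun k _ => dedicatedScore_le u w k j j) ?_
    refine le_trans (le_of_eq ?_) (Finset.le_sup (f := fun k => ∑ a : Fin h,
      (if (decide (a ∈ u j) = decide (a ∈ u k) ∧ decide (a ∈ w j) = decide (a ∈ w k)) then 1 else 0 : ℕ))
      (mem_univ j))
    simp
  -- left-hand side: a moved row scores at most `h − 1`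
  obtain ⟨j₀, hj₀⟩ : ∃ j₀, σ j₀ ≠ j₀ := by
    by_contra hcon
    push Not at hcon
    exact hσ (Equiv.ext hcon)
  have hle : ∀ j : Fin r, univ.sup (fun k => ∑ a : Fin h,
      (if (decide (a ∈ u (σ j)) = decide (a ∈ u k) ∧ decide (a ∈ w j) = decide (a ∈ w k)) then 1 else 0 : ℕ))
      ≤ h := fun j => Finset.sup_le fun k _ => dedicatedScore_le u w k (σ j) j
  have hlt : univ.sup (fun k => ∑ a : Fin h,
      (if (decide (a ∈ u (σ j₀)) = decide (a ∈ u k) ∧ decide (a ∈ w j₀) = decide (a ∈ w k)) then 1 else 0 : ℕ))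
      < h := by
    refine (Finset.sup_lt_iff (lt_of_lt_of_le Nat.zero_lt_one (le_trans (by norm_num) hh))).mpr
      fun k _ => lt_of_le_of_ne (dedicatedScore_le u w k (σ j₀) j₀) fun heq => ?_
    obtain ⟨h1, h2⟩ := eq_of_dedicatedScore_eq u w k (σ j₀) j₀ heq
    exact hj₀ ((hu h1).trans (hw h2).symm)
  calc ∑ j, univ.sup (fun k => ∑ a : Fin h, (if (decide (a ∈ u (σ j)) = decide (a ∈ u k) ∧
          decide (a ∈ w j) = decide (a ∈ w k)) then 1 else 0 : ℕ))
      < ∑ _j : Fin r, h := Finset.sum_lt_sum (fun j _ => hle j) ⟨j₀, mem_univ _, hlt⟩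
    _ = ∑ j, univ.sup (fun k => ∑ a : Fin h, (if (decide (a ∈ u j) = decide (a ∈ u k) ∧
          decide (a ∈ w j) = decide (a ∈ w k)) then 1 else 0 : ℕ)) :=
        Finset.sum_congr rfl fun j _ => (hdiag j).symm

/-- **Item 19717 on the polynomial-size range**, in the item's quantifier shape with the extra hypothesis
`r ≤ (h+h)^c`: for every `c` there are `b = c + 2` and `h₀ = 4`. -/
theorem partitionMinorsHitByVP_smallLayouts (c : ℕ) :
    ∃ b h₀ : ℕ, ∀ h : ℕ, h₀ ≤ h → ∀ (r : ℕ) (u w : Fin r → Finset (Fin h)), r ≤ (h + h) ^ c →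
      Function.Injective u → Function.Injective w →
      ∃ f ∈ SmallCircuits ℂ (h + h) b,
        (Matrix.of fun i j : Fin r => MvPolynomial.coeff
          (∑ a ∈ u i, Finsupp.single (Fin.castAdd h a) 1 +
            ∑ c ∈ w j, Finsupp.single (Fin.natAdd h c) 1) f).det ≠ 0 :=
  ⟨c + 2, 4, fun h hh r u w hr hu hw => partitionMinor_hit_of_card_le c h hh r hr u w hu hw⟩

end Summit.ValiantsHypothesis.ValiantsHypothesis.Theorems.BarrierLever.ProductStateSums
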